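import Literature.AlgebraicGeometry.Resolution.AlterationsSemiStableCodimTwoBlowupFibreModels
import Mathlib.RingTheory.TensorProduct.MvPolynomial
import HarnessLib

/-!
# `WildQuotients.SummitReduction` (stmt-ResolutionOfSingularities-16324), line `FramePerfect`:
# level-bijective maps and the node `κ[u,v]/(uv)` — algebra lemmas for stub `stub_pair_quasiSplitBaseChange`

Route `ResolutionOfSingularities/WildQuotients`, crux `SummitReduction`; first helper file of stub
`stub_pair_quasiSplitBaseChange` (quasi-splitness of a semi-stable curve is stable under base change;
de Jong 1997, p. 614–615: "a rational singular point with rational tangents stays so") of the line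
skeleton `Cruxes/SummitReduction/Lines/FramePerfect.lean` (v7). Pure commutative algebra,
hypothesis-free, feeding `…StubPairQuasiSplitBaseChangeAlgebra.lean` (the completed base change
`(κ' ⊗_κ B)^ ≅ κ'⟦u,v⟧/(uv)` of an ordinary double point `B^ ≅ κ⟦u,v⟧/(uv)`):

* `levelBijective_comp_ringEquiv`, `levelBijective_lTensor` — maps with bijective levels
  `S/Iⁿ → S₂/I₂ⁿ` (the input of `adicCompletionEquivOfQuotientMap`, `CompletionBaseChange.lean`)
  are stable under post-composition with ring isomorphisms and under base change `κ' ⊗_κ -`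
  (right exactness of `⊗`: Mathlib's `Algebra.TensorProduct.tensorQuotientEquiv`);
* `exists_completion_algebraicNodeRing_equiv` (registered sub-goal stub) — the completion of
  `κ[u,v]/(uv)` (`DeJong1996.AlgebraicNodeRing κ 0`) at the origin is `κ⟦u,v⟧/(uv)` BY THE
  ISOMORPHISM EXTENDING `p ↦ p` (the tree's `quotientCompletionEquiv`, Matsumura Thm. 8.11, and
  `completionOriginEquiv`; the tree's `nonempty_ringEquiv_completion_of_isLocalization_nodeOrigin`
  forgets the map);
* `exists_baseChange_algebraicNodeRing_equiv` — `κ' ⊗_κ κ[u,v]/(uv) ≅ κ'[u,v]/(uv)`, `a ⊗ 1 ↦ a`,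
  matching the ideals of the origins (Mathlib's `MvPolynomial.algebraTensorAlgEquiv`).
-/

set_option linter.dupNamespace false

noncomputable section

open TensorProduct AdicCompletion
open Literature.AlgebraicGeometry.Resolution

namespace Summit.ResolutionOfSingularities.ResolutionOfSingularities.Theorems

universe u

/-! ## Level-bijective maps: composition with isomorphisms, base change -/

section LevelBijective

variable {S S₂ S₃ : Type u} [CommRing S] [CommRing S₂] [CommRing S₃]

/-- **Post-composing a map with bijective levels `S/Iⁿ → S₂/I₂ⁿ` with a ring isomorphism
`σ : S₂ ≅ S₃` gives a map with bijective levels `S/Iⁿ → S₃/σ(I₂)ⁿ`** (the level map factors through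
`S₂/I₂ⁿ ≅ S₃/σ(I₂)ⁿ`). [folklore] -/
theorem levelBijective_comp_ringEquiv (I : Ideal S) (I₂ : Ideal S₂) (f : S →+* S₂) (h : I.map f ≤ I₂)
    (hb : ∀ n, Function.Bijective (Ideal.quotientMap (I₂ ^ n) f (pow_le_comap_pow_of_map_le f h n)))
    (σ : S₂ ≃+* S₃) (I₃ : Ideal S₃) (hI₃ : I₂.map σ.toRingHom = I₃) :
    ∃ h₃ : I.map (σ.toRingHom.comp f) ≤ I₃, ∀ n, Function.Bijective
      (Ideal.quotientMap (I₃ ^ n) (σ.toRingHom.comp f) (pow_le_comap_pow_of_map_le _ h₃ n)) := by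
  have h₃ : I.map (σ.toRingHom.comp f) ≤ I₃ := by
    rw [← Ideal.map_map, ← hI₃]
    exact Ideal.map_mono h
  refine ⟨h₃, fun n => ?_⟩
  have hpow : I₃ ^ n = (I₂ ^ n).map σ.toRingHom := by rw [Ideal.map_pow, hI₃]
  let τ : (S₂ ⧸ I₂ ^ n) ≃+* S₃ ⧸ I₃ ^ n :=
    Ideal.quotientEquiv (I₂ ^ n) (I₃ ^ n) σ (by rw [hpow, RingEquiv.toRingHom_eq_coe])
  have hcomp : (Ideal.quotientMap (I₃ ^ n) (σ.toRingHom.comp f)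
      (pow_le_comap_pow_of_map_le _ h₃ n) : S ⧸ I ^ n → S₃ ⧸ I₃ ^ n) =
      τ ∘ (Ideal.quotientMap (I₂ ^ n) f (pow_le_comap_pow_of_map_le f h n)) := by
    funext z
    obtain ⟨s, rfl⟩ := Ideal.Quotient.mk_surjective z
    rw [Ideal.quotientMap_mk, Function.comp_apply, Ideal.quotientMap_mk, Ideal.quotientEquiv_mk]
    rfl
  rw [hcomp]
  exact τ.bijective.comp (hb n)

variable {R : Type u} [CommRing R] (R' : Type u) [CommRing R'] [Algebra R R']
  {C C₂ : Type u} [CommRing C] [CommRing C₂] [Algebra R C] [Algebra R C₂]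
  (g : C →ₐ[R] C₂) (I : Ideal C) (I₂ : Ideal C₂) (h : I.map g.toRingHom ≤ I₂)

/-- The base change `κ' ⊗ g` of `g` intertwines the structure maps `c ↦ 1 ⊗ c`. [folklore] -/
theorem map_id_comp_tensorInr :
    (Algebra.TensorProduct.map (AlgHom.id R' R') g).toRingHom.comp (tensorInr R R' C) =
      (tensorInr R R' C₂).comp g.toRingHom := by
  ext c
  simp only [RingHom.coe_comp, AlgHom.toRingHom_eq_coe, RingHom.coe_coe, Function.comp_apply,
    tensorInr_apply, Algebra.TensorProduct.map_tmul, AlgHom.coe_id, id_eq]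

include h in
/-- The base change `κ' ⊗ g` maps `I(κ' ⊗ C)` into `I₂(κ' ⊗ C₂)`. [folklore] -/
theorem map_map_tensorInr_le :
    (I.map (tensorInr R R' C)).map (Algebra.TensorProduct.map (AlgHom.id R' R') g).toRingHom ≤
      I₂.map (tensorInr R R' C₂) := by
  rw [Ideal.map_map, map_id_comp_tensorInr, ← Ideal.map_map]
  exact Ideal.map_mono h

/-- **Base change preserves level-bijectivity**: if `g : C → C₂` has bijective levels
`C/Iⁿ → C₂/I₂ⁿ`, so has `κ' ⊗ g : κ' ⊗ C → κ' ⊗ C₂` for the extended ideals (right exactness of the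
tensor product: `(κ' ⊗ C)/Iⁿ(κ' ⊗ C) = κ' ⊗ C/Iⁿ`, Mathlib's `tensorQuotientEquiv`). [folklore] -/
theorem levelBijective_lTensor
    (hb : ∀ n, Function.Bijective
      (Ideal.quotientMap (I₂ ^ n) g.toRingHom (pow_le_comap_pow_of_map_le _ h n))) (n : ℕ) :
    Function.Bijective (Ideal.quotientMap ((I₂.map (tensorInr R R' C₂)) ^ n)
      (Algebra.TensorProduct.map (AlgHom.id R' R') g).toRingHom
      (pow_le_comap_pow_of_map_le _ (map_map_tensorInr_le R' g I I₂ h) n)) := by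
  set G : R' ⊗[R] C →ₐ[R'] R' ⊗[R] C₂ := Algebra.TensorProduct.map (AlgHom.id R' R') g with hG
  -- the ideals as extensions of the powers along `includeRight`
  have hpow : (I.map (tensorInr R R' C)) ^ n =
      (I ^ n).map (Algebra.TensorProduct.includeRight : C →ₐ[R] R' ⊗[R] C) := by
    rw [← Ideal.map_pow]; rfl
  have hpow₂ : (I₂.map (tensorInr R R' C₂)) ^ n =
      (I₂ ^ n).map (Algebra.TensorProduct.includeRight : C₂ →ₐ[R] R' ⊗[R] C₂) := by
    rw [← Ideal.map_pow]; rfl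
  have hle : (I ^ n).map (Algebra.TensorProduct.includeRight : C →ₐ[R] R' ⊗[R] C) ≤
      ((I₂ ^ n).map (Algebra.TensorProduct.includeRight : C₂ →ₐ[R] R' ⊗[R] C₂)).comap G.toRingHom := by
    rw [← hpow, ← hpow₂]
    exact pow_le_comap_pow_of_map_le _ (map_map_tensorInr_le R' g I I₂ h) n
  rw [bijective_quotientMap_congr hpow₂ G.toRingHom hpow _ hle]
  -- the level isomorphism `(κ' ⊗ C)/Iⁿ ≅ κ' ⊗ C/Iⁿ ≅ κ' ⊗ C₂/I₂ⁿ ≅ (κ' ⊗ C₂)/I₂ⁿ`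
  let gbar : (C ⧸ I ^ n) ≃ₐ[R] (C₂ ⧸ I₂ ^ n) :=
    AlgEquiv.ofBijective (Ideal.quotientMapₐ (I₂ ^ n) g (pow_le_comap_pow_of_map_le _ h n)) (hb n)
  let e₁ := (Algebra.TensorProduct.tensorQuotientEquiv (R := R) R' C R' (I ^ n)).symm
  let mid : R' ⊗[R] (C ⧸ I ^ n) ≃ₐ[R'] R' ⊗[R] (C₂ ⧸ I₂ ^ n) :=
    Algebra.TensorProduct.congr (AlgEquiv.refl : R' ≃ₐ[R'] R') gbar
  let e₂ := Algebra.TensorProduct.tensorQuotientEquiv (R := R) R' C₂ R' (I₂ ^ n)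
  let E := (e₁.trans mid).trans e₂
  have key : (Ideal.quotientMap ((I₂ ^ n).map (Algebra.TensorProduct.includeRight : C₂ →ₐ[R] R' ⊗[R] C₂))
      G.toRingHom hle : _ → _) = E := by
    funext z
    obtain ⟨t, rfl⟩ := Ideal.Quotient.mk_surjective z
    rw [Ideal.quotientMap_mk]
    induction t using TensorProduct.induction_on with
    | zero => simp only [_root_.map_zero]
    | tmul r c =>
      simp only [E, e₁, e₂, mid, gbar, AlgEquiv.trans_apply,
        Algebra.TensorProduct.tensorQuotientEquiv_symm_apply_tmul, Algebra.TensorProduct.congr_apply,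
        Algebra.TensorProduct.map_tmul, AlgEquiv.toAlgHom_apply, AlgEquiv.coe_refl, id_eq,
        AlgEquiv.ofBijective_apply, Ideal.quotient_map_mkₐ, Ideal.Quotient.mkₐ_eq_mk,
        Algebra.TensorProduct.tensorQuotientEquiv_apply_tmul, AlgHom.toRingHom_eq_coe, RingHom.coe_coe, hG,
        AlgHom.coe_id]
    | add x y hx hy => simp only [_root_.map_add, hx, hy]
  rw [key]
  exact E.bijective

end LevelBijective

/-! ## The node `κ[u,v]/(uv)`: completion at the origin and base change -/

section NodeRing

open MvPolynomial DeJong1996 DeJong1996.AlgebraicNodeRing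

/-- **The completion of `κ[u,v]/(uv)` at the origin is `κ⟦u,v⟧/(uv)`, by the isomorphism extending
`p ↦ p`** (`(k[x,y]/(xy))^_{(x,y)} ≅ k[x,y]^_{(x,y)}/(xy) ≅ k⟦x,y⟧/(xy)`: the tree's
`quotientCompletionEquiv`, Matsumura Thm. 8.11, and `completionOriginEquiv`). [cite: Matsumura1987, Thm. 8.11] -/
theorem exists_completion_algebraicNodeRing_equiv (k : Type u) [Field k] :
    ∃ ν : AdicCompletion (DeJong1996.AlgebraicNodeRing.nodeOrigin k) (DeJong1996.AlgebraicNodeRing k (0 : k)) ≃+*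
        MvPowerSeries (Fin 2) k ⧸
          Ideal.span {(MvPowerSeries.X 0 * MvPowerSeries.X 1 : MvPowerSeries (Fin 2) k)},
      ∀ p : MvPolynomial (Fin 2) k,
        ν (AdicCompletion.of (DeJong1996.AlgebraicNodeRing.nodeOrigin k) _ (DeJong1996.AlgebraicNodeRing.mk k 0 p)) =
          Ideal.Quotient.mk _ (p : MvPowerSeries (Fin 2) k) := by
  set P := MvPolynomial (Fin 2) k
  set J : Ideal P := Ideal.span {algNodeRelation k (0 : k)} with hJ
  let e₂ : AdicCompletion (nodeOrigin k) (AlgebraicNodeRing k (0 : k)) ≃+*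
      (AdicCompletion (originIdeal k 2) P ⧸ J.map (algebraMap P (AdicCompletion (originIdeal k 2) P))) :=
    (quotientCompletionEquiv (originIdeal k 2) J).symm
  have hJ' : Ideal.span {(MvPowerSeries.X 0 * MvPowerSeries.X 1 : MvPowerSeries (Fin 2) k)} =
      (J.map (algebraMap P (AdicCompletion (originIdeal k 2) P))).map (completionOriginEquiv k).toRingHom := by
    rw [hJ, Ideal.map_span, Set.image_singleton, Ideal.map_span, Set.image_singleton,
      AdicCompletion.algebraMap_apply, Algebra.algebraMap_self, RingHom.id_apply,
      RingEquiv.toRingHom_eq_coe, RingHom.coe_coe, completionOriginEquiv_of, coe_algNodeRelation_zero]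
  let e₃ : (AdicCompletion (originIdeal k 2) P ⧸ J.map (algebraMap P (AdicCompletion (originIdeal k 2) P))) ≃+*
      MvPowerSeries (Fin 2) k ⧸ Ideal.span {(MvPowerSeries.X 0 * MvPowerSeries.X 1 : MvPowerSeries (Fin 2) k)} :=
    Ideal.quotientEquiv _ _ (completionOriginEquiv k) (by rw [hJ']; rfl)
  refine ⟨e₂.trans e₃, fun p => ?_⟩
  rw [RingEquiv.trans_apply]
  have h2 : e₂ (of (nodeOrigin k) _ (AlgebraicNodeRing.mk k 0 p)) =
      Ideal.Quotient.mk _ (of (originIdeal k 2) P p) := by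
    apply (quotientCompletionEquiv (originIdeal k 2) J).injective
    change (quotientCompletionEquiv _ J) ((quotientCompletionEquiv _ J).symm _) = _
    rw [RingEquiv.apply_symm_apply, quotientCompletionEquiv_mk_of]
    rfl
  rw [h2]
  simp only [e₃]
  rw [Ideal.quotientEquiv_mk, completionOriginEquiv_of]

variable (k : Type u) [Field k]

/-- The ideal of the origin of `xy = 0` is generated by `ū`, `v̄`. [folklore] -/
theorem nodeOrigin_eq_span :
    nodeOrigin k = Ideal.span {AlgebraicNodeRing.u k (0 : k), AlgebraicNodeRing.v k (0 : k)} := by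
  unfold nodeOrigin
  rw [originIdeal_eq_span, Ideal.map_span]
  congr 1
  ext z
  simp only [Set.mem_image, Set.mem_range, Set.mem_insert_iff, Set.mem_singleton_iff]
  constructor
  · rintro ⟨q, ⟨i, rfl⟩, rfl⟩
    fin_cases i
    · exact Or.inl rfl
    · exact Or.inr rfl
  · rintro (rfl | rfl)
    · exact ⟨X 0, ⟨0, rfl⟩, rfl⟩
    · exact ⟨X 1, ⟨1, rfl⟩, rfl⟩

variable (k' : Type u) [Field k'] [Algebra k k']

/-- **Base change of the node: `κ' ⊗_κ κ[u,v]/(uv) ≅ κ'[u,v]/(uv)`**, sending `a ⊗ 1 ↦ a` and the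
ideal `(ū, v̄)(κ' ⊗ κ[u,v]/(uv))` of the origin onto the ideal `(ū, v̄)` of the origin (Mathlib's
`MvPolynomial.algebraTensorAlgEquiv` and `tensorQuotientEquiv`). [folklore] -/
theorem exists_baseChange_algebraicNodeRing_equiv :
    ∃ β : k' ⊗[k] AlgebraicNodeRing k (0 : k) ≃+* AlgebraicNodeRing k' (0 : k'),
      (∀ a : k', β (a ⊗ₜ[k] 1) = algebraMap k' _ a) ∧
      ((nodeOrigin k).map (tensorInr k k' (AlgebraicNodeRing k (0 : k)))).map β.toRingHom =
        nodeOrigin k' := by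
  let J : Ideal (MvPolynomial (Fin 2) k) := Ideal.span {algNodeRelation k (0 : k)}
  let J' : Ideal (MvPolynomial (Fin 2) k') := Ideal.span {algNodeRelation k' (0 : k')}
  -- `κ' ⊗ P/J ≅ (κ' ⊗ P)/J`
  let e₁ : k' ⊗[k] AlgebraicNodeRing k (0 : k) ≃ₐ[k'] (k' ⊗[k] MvPolynomial (Fin 2) k) ⧸ J.map
      (Algebra.TensorProduct.includeRight : MvPolynomial (Fin 2) k →ₐ[k] k' ⊗[k] MvPolynomial (Fin 2) k) :=
    Algebra.TensorProduct.tensorQuotientEquiv k' (MvPolynomial (Fin 2) k) k' J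
  -- `κ' ⊗ P ≅ P'`
  let α : k' ⊗[k] MvPolynomial (Fin 2) k ≃ₐ[k'] MvPolynomial (Fin 2) k' :=
    MvPolynomial.algebraTensorAlgEquiv k k'
  have hα : ∀ p : MvPolynomial (Fin 2) k, α ((1 : k') ⊗ₜ[k] p) = MvPolynomial.map (algebraMap k k') p :=
    fun p => by
    simp only [α, MvPolynomial.algebraTensorAlgEquiv_tmul, one_smul]
  have hJα : J' = (J.map (Algebra.TensorProduct.includeRight :
      MvPolynomial (Fin 2) k →ₐ[k] k' ⊗[k] MvPolynomial (Fin 2) k)).map (α : _ →+* _) := by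
    simp only [J, J']
    rw [Ideal.map_span, Set.image_singleton, Ideal.map_span, Set.image_singleton]
    congr 2
    change algNodeRelation k' 0 = α ((Algebra.TensorProduct.includeRight :
      MvPolynomial (Fin 2) k →ₐ[k] k' ⊗[k] MvPolynomial (Fin 2) k) (algNodeRelation k 0))
    rw [Algebra.TensorProduct.includeRight_apply, hα, algNodeRelation, algNodeRelation]
    simp only [_root_.map_sub, _root_.map_mul, MvPolynomial.map_X, _root_.map_zero]
  let e₂ : ((k' ⊗[k] MvPolynomial (Fin 2) k) ⧸ J.map (Algebra.TensorProduct.includeRight :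
      MvPolynomial (Fin 2) k →ₐ[k] k' ⊗[k] MvPolynomial (Fin 2) k)) ≃+* AlgebraicNodeRing k' (0 : k') :=
    Ideal.quotientEquiv _ J' α.toRingEquiv (by rw [hJα]; rfl)
  let β : k' ⊗[k] AlgebraicNodeRing k (0 : k) ≃+* AlgebraicNodeRing k' (0 : k') := e₁.toRingEquiv.trans e₂
  have hβ : ∀ (a : k') (p : MvPolynomial (Fin 2) k), β (a ⊗ₜ[k] AlgebraicNodeRing.mk k 0 p) =
      AlgebraicNodeRing.mk k' 0 (a • MvPolynomial.map (algebraMap k k') p) := by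
    intro a p
    simp only [β, RingEquiv.trans_apply, AlgEquiv.coe_ringEquiv, e₁, e₂, AlgebraicNodeRing.mk_apply]
    rw [Algebra.TensorProduct.tensorQuotientEquiv_apply_tmul, Ideal.quotientEquiv_mk]
    congr 1
    change α (a ⊗ₜ[k] p) = _
    rw [MvPolynomial.algebraTensorAlgEquiv_tmul]
  refine ⟨β, fun a => ?_, ?_⟩
  · have h1 : (1 : AlgebraicNodeRing k (0 : k)) = AlgebraicNodeRing.mk k 0 1 := by rw [map_one]
    rw [h1, hβ, map_one, AlgebraicNodeRing.algebraMap_eq, AlgebraicNodeRing.mk_apply]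
    congr 1
    rw [Algebra.smul_def, mul_one, MvPolynomial.algebraMap_eq]
  · rw [nodeOrigin_eq_span, nodeOrigin_eq_span, Ideal.map_span, Ideal.map_span, Set.image_insert_eq,
      Set.image_singleton, Set.image_insert_eq, Set.image_singleton]
    congr 2
    · rw [tensorInr_apply, RingEquiv.toRingHom_eq_coe, RingHom.coe_coe, AlgebraicNodeRing.u, AlgebraicNodeRing.u]
      have := hβ 1 (X 0)
      rw [one_smul, MvPolynomial.map_X] at this
      exact this
    · rw [tensorInr_apply, RingEquiv.toRingHom_eq_coe, RingHom.coe_coe, AlgebraicNodeRing.v, AlgebraicNodeRing.v]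
      have := hβ 1 (X 1)
      rw [one_smul, MvPolynomial.map_X] at this
      rw [this]

end NodeRing

end Summit.ResolutionOfSingularities.ResolutionOfSingularities.Theorems

end
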